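import Mathlib

/-!
# PermBlind41 — the permutahedral passenger is clique-row blind (a NON-CUBE blind passenger)

W6-R1 (b142) enemy hunt, val-idea-41 g3, crux `FifoMatching.NNDivisionHard` (stmt 21181).

**Theorem (`permPassenger_cliqueBlind`).**  For every `n` there are entrywise nonnegative
matrices `U` (rows `a ⊆ [n]`) and `V` (columns `(b ⊆ [n], π ∈ S_n)`) with an index set of
`(n+1)·(8n²+1)` slots such that for all `a b π`

  `(1 - |a ∩ b|)² + (4n+2) · inv(a;π) = ∑ₛ U a s · V (b,π) s`,

where `inv(a;π) = #{(l ∈ a, l' ∉ a) : π l' < π l}`.  The left side is exactly the slack of the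
clique row `udRow a` against the column `udPt b + q_π` of `COR(n) + Q^Π_λ`, where
`Q^Π_λ = conv{−λ·diag(π) : π ∈ S_n}` is the (scaled, negated) PERMUTAHEDRON placed on the
diagonal (`⟨udRow a, −λ diag π⟩ = −λ Σ_{l∈a} π(l)`, maximal iff `a` occupies the first `|a|`
positions of `π`, recourse `λ·inv(a;π)`).  Hence `Q^Π_{4n+2}` is CLIQUE-ROW BLIND with
`O(n³)` slots although it is not an affine cube (it has `n!` vertices and extension complexity
`Θ(n log n)` [Goemans 2015]); all blind passengers on record so far (Q♮, Q∘, Q^c, Q^w) were cubes.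

**The explicit factorization** (row `a` with `|a| = k`; the column then knows the located set
`I = I^π_k` = first `k` elements of `π` and `s' = |I ∩ b|`; `y_l = [l ∈ a∖I]`, `z_l = [l ∈ I∖a]`,
`d = |a∖I| = |I∖a|`, `m = |(I∖a)∩b|`, `t = |(a∖I)∩b|`, so that `|a∩b| = s' − m + t`):
`A0 = (1−s')²`, `A1 = m²`, `A2 = t²`, `A3 = Σ_{l∉I,l'∈I} (y_l z_{l'}(2−2b_lb_{l'}) + 2 y_l x_{l'})
 = 2kd − 2mt`, `A4+A6 = Σ_{l∉I} y_l (2 − 2b_l + 2s'b_l + λ(π(l)−k) − 4k − 2)`,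
`A5 = Σ_{l'∈I} z_{l'}(2k + 2(1−s')b_{l'})`, `A7 = λ Σ x_l x_{l''}[π l > k][π l'' > π l]`,
`A8 = λ Σ (1−x_{l'}) x_l [π l' < π l ≤ k]`; and `λ·inv = λΣ_{l∈a∖I}(π(l)−k) + A7 + A8` because an
`a`-element outside `I` at position `p` has exactly `p − k + #{a-elements after it}` non-`a`
predecessors.  Every column factor is `≥ 0` as soon as `λ ≥ 4k+2` (`s' ≤ k`).  The identity was
first verified numerically (`pub/ideators/val-idea-41/check_perm_nmf.py`, exact for all
`(a,b,π)` at `n ≤ 4`) and is kernel-checked below (`slack_identity`).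

**Why it matters for C⁺ = `LocatedPencilLaw`.**  `Q^Π` has tilt-DEAD columns (only diagonal
entries move), passes the located-face tests of `LocatedFace41` (its located faces are products
of sub-permutahedra) and the single-column negative-tilt test (CRITIC-wave6 N20) — so it is the
one enemy candidate for C⁺ that survives every recorded test; by the off-diagonal shadow sieve
(`OffDiagShadow41.permPassenger_three_pow_le`, = PROP D₀) it is nevertheless DEAD at COR-VIRTUAL.
For `Q^Π` an off-diagonal entry tilt only adds a separable COR-side cost, so
C⁺-blindness of `Q^Π` ⇔ blindness of the DIAGONALLY tilted rows `(a, w)`, `w ∈ ℝⁿ`, slack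
`(1−|a∩b|)² + Σ_l (w_l⁺(1−b_l) + w_l⁻ b_l) + λ·Def(𝟙_a + w; π)`,
`Def(c;π) = Σ_{c_l > c_{l'}, π l > π l'} (c_l − c_{l'})`.  OPEN (the W6-R1 dichotomy): a uniform-in-`w`
factorization ⇒ ¬`LocatedPencilLaw` by a non-cube while COR-VIRTUAL stands; a diagonal tilt
exposing UDISJ on `Q^Π` ⇒ `Q^Π` decided and no enemy candidate survives.

21181 OPEN; C⁺ OPEN; VP ≠ VNP NOT proved.  This file refutes nothing new in Law currency
(`cliqueRows.Law` is already refuted by cubes, CliqueRowLawFalse p671347); its content is the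
first non-cube witness and the explicit `O(n³)` factorization.
-/

set_option linter.dupNamespace false
set_option linter.unusedVariables false

namespace Summit.ValiantsHypothesis.ValiantsHypothesis.Cruxes.NNDivisionHard.PermBlind41

open Finset BigOperators

noncomputable section

variable {n : ℕ}

/-! ## §0 Indicators and basic sums -/

/-- `[l ∈ a]` as a real number. -/
def xa (a : Finset (Fin n)) (l : Fin n) : ℝ := if l ∈ a then 1 else 0

/-- `[π l < k]`: `l` is among the first `k` positions of `π` (the located set `I^π_k`). -/
def io (π : Equiv.Perm (Fin n)) (k : ℕ) (l : Fin n) : ℝ := if (π l : ℕ) < k then 1 else 0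

/-- inversion kernel `[π l' < π l]`. -/
def K (π : Equiv.Perm (Fin n)) (l l' : Fin n) : ℝ := if (π l' : ℕ) < (π l : ℕ) then 1 else 0

/-- `inv(a;π) = #{(l ∈ a, l' ∉ a) : π l' < π l}` as a real double sum. -/
def invR (a : Finset (Fin n)) (π : Equiv.Perm (Fin n)) : ℝ :=
  ∑ l, ∑ l', xa a l * (1 - xa a l') * K π l l'

/-- `inv(a;π)` as a cardinality. -/
def inv (a : Finset (Fin n)) (π : Equiv.Perm (Fin n)) : ℕ :=
  ((univ : Finset (Fin n × Fin n)).filter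
    (fun p => p.1 ∈ a ∧ p.2 ∉ a ∧ (π p.2 : ℕ) < (π p.1 : ℕ))).card

/-- The clique-row slack of `COR(n) + Q^Π_λ`: `UDISJ + λ·inv`. -/
def M (lam : ℝ) (a b : Finset (Fin n)) (π : Equiv.Perm (Fin n)) : ℝ :=
  (1 - ∑ l, xa a l * xa b l) ^ 2 + lam * invR a π

lemma xa_nonneg (a : Finset (Fin n)) (l : Fin n) : 0 ≤ xa a l := by
  unfold xa; split_ifs <;> norm_num

lemma xa_le_one (a : Finset (Fin n)) (l : Fin n) : xa a l ≤ 1 := by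
  unfold xa; split_ifs <;> norm_num

lemma xa_mul_self (a : Finset (Fin n)) (l : Fin n) : xa a l * xa a l = xa a l := by
  unfold xa; split_ifs <;> norm_num

lemma io_nonneg (π : Equiv.Perm (Fin n)) (k : ℕ) (l : Fin n) : 0 ≤ io π k l := by
  unfold io; split_ifs <;> norm_num

lemma io_le_one (π : Equiv.Perm (Fin n)) (k : ℕ) (l : Fin n) : io π k l ≤ 1 := by
  unfold io; split_ifs <;> norm_num

lemma K_nonneg (π : Equiv.Perm (Fin n)) (l l' : Fin n) : 0 ≤ K π l l' := by
  unfold K; split_ifs <;> norm_num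

lemma sum_xa (a : Finset (Fin n)) : ∑ l, xa a l = a.card := by
  unfold xa
  rw [Finset.sum_boole]
  congr 2
  ext l; simp

lemma sum_xa_mul_xa (a b : Finset (Fin n)) : ∑ l, xa a l * xa b l = ((a ∩ b).card : ℝ) := by
  have h : ∀ l, xa a l * xa b l = if l ∈ a ∩ b then 1 else 0 := by
    intro l; unfold xa
    by_cases h1 : l ∈ a <;> by_cases h2 : l ∈ b <;> simp [h1, h2]
  simp_rw [h]
  rw [Finset.sum_boole]
  congr 2
  ext l; simp

/-- `Σ_i [i < m] = m` over `Fin n`, for `m ≤ n`. -/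
lemma sum_indicator_lt (m : ℕ) (hm : m ≤ n) :
    ∑ i : Fin n, (if (i : ℕ) < m then (1 : ℝ) else 0) = m := by
  rw [Finset.sum_boole]
  have : ((univ : Finset (Fin n)).filter (fun i : Fin n => (i : ℕ) < m)).card = m := by
    rw [Fin.card_filter_val_lt, min_eq_right hm]
  rw [this]

/-- `|I^π_k| = k`. -/
lemma sum_io (π : Equiv.Perm (Fin n)) (k : ℕ) (hk : k ≤ n) : ∑ l, io π k l = k := by
  unfold io
  rw [Equiv.sum_comp π (fun i : Fin n => if (i : ℕ) < k then (1 : ℝ) else 0)]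
  exact sum_indicator_lt k hk

/-- `Σ_{l'} [π l' < π l] = π l` (the number of predecessors). -/
lemma sum_K (π : Equiv.Perm (Fin n)) (l : Fin n) : ∑ l', K π l l' = ((π l : ℕ) : ℝ) := by
  unfold K
  rw [Equiv.sum_comp π (fun i : Fin n => if (i : ℕ) < (π l : ℕ) then (1 : ℝ) else 0)]
  exact sum_indicator_lt (π l : ℕ) (le_of_lt (π l).isLt)

/-- trichotomy: `[π l' < π l] + [π l < π l'] = [l ≠ l']`. -/
lemma K_add_K (π : Equiv.Perm (Fin n)) (l l' : Fin n) :
    K π l l' + K π l' l = if l = l' then 0 else 1 := by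
  by_cases h : l = l'
  · subst h; simp [K]
  · have hne : (π l : ℕ) ≠ (π l' : ℕ) := by
      intro h'
      apply h
      exact π.injective (Fin.ext h')
    rcases lt_trichotomy (π l' : ℕ) (π l : ℕ) with h1 | h1 | h1
    · simp [K, h, h1, not_lt.mpr h1.le]
    · exact absurd h1.symm hne
    · simp [K, h, h1, not_lt.mpr h1.le]

/-- a predecessor of a located element is located: `[π l < k]·[π l' < π l]·[¬ π l' < k] = 0`. -/
lemma io_K_io (π : Equiv.Perm (Fin n)) (k : ℕ) (l l' : Fin n) :
    io π k l * K π l l' * (1 - io π k l') = 0 := by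
  unfold io K
  by_cases h1 : (π l : ℕ) < k <;> by_cases h2 : (π l' : ℕ) < (π l : ℕ) <;> simp [h1, h2]
  have h3 : (π l' : ℕ) < k := lt_trans h2 h1
  simp [h3]

/-- `inv` (cardinality) equals `invR` (real double sum). -/
lemma inv_cast (a : Finset (Fin n)) (π : Equiv.Perm (Fin n)) : (inv a π : ℝ) = invR a π := by
  unfold inv invR
  have h : ∀ l l', xa a l * (1 - xa a l') * K π l l' =
      if (l ∈ a ∧ l' ∉ a ∧ (π l' : ℕ) < (π l : ℕ)) then 1 else 0 := by
    intro l l'; unfold xa K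
    by_cases h1 : l ∈ a <;> by_cases h2 : l' ∈ a <;> by_cases h3 : (π l' : ℕ) < (π l : ℕ) <;>
      simp [h1, h2, h3]
  simp_rw [h]
  rw [← Fintype.sum_prod_type', Finset.sum_boole]

/-! ## §1 Double-sum bookkeeping -/

lemma dsum_congr {F G : Fin n → Fin n → ℝ} (h : ∀ l l', F l l' = G l l') :
    ∑ l, ∑ l', F l l' = ∑ l, ∑ l', G l l' := by
  refine Finset.sum_congr rfl (fun l _ => Finset.sum_congr rfl (fun l' _ => h l l'))

lemma dsum_prod (f g : Fin n → ℝ) : ∑ l, ∑ l', f l * g l' = (∑ l, f l) * (∑ l', g l') := by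
  rw [Finset.sum_mul_sum]

lemma dsum_add (F G : Fin n → Fin n → ℝ) :
    ∑ l, ∑ l', (F l l' + G l l') = (∑ l, ∑ l', F l l') + ∑ l, ∑ l', G l l' := by
  rw [← Finset.sum_add_distrib]
  refine Finset.sum_congr rfl (fun l _ => Finset.sum_add_distrib)

lemma dsum_sub (F G : Fin n → Fin n → ℝ) :
    ∑ l, ∑ l', (F l l' - G l l') = (∑ l, ∑ l', F l l') - ∑ l, ∑ l', G l l' := by
  rw [← Finset.sum_sub_distrib]
  refine Finset.sum_congr rfl (fun l _ => Finset.sum_sub_distrib _ _)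

lemma dsum_const_mul (c : ℝ) (F : Fin n → Fin n → ℝ) :
    ∑ l, ∑ l', c * F l l' = c * ∑ l, ∑ l', F l l' := by
  rw [Finset.mul_sum]
  refine Finset.sum_congr rfl (fun l _ => by rw [Finset.mul_sum])

lemma dsum_delta (F : Fin n → Fin n → ℝ) :
    ∑ l, ∑ l', (if l' = l then (1 : ℝ) else 0) * F l l' = ∑ l, F l l := by
  refine Finset.sum_congr rfl (fun l _ => ?_)
  have : ∀ l', (if l' = l then (1 : ℝ) else 0) * F l l' = if l' = l then F l l' else 0 := by
    intro l'; split_ifs <;> simp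
  simp_rw [this]
  simp

/-! ## §2 The atom families -/

/-- `s' = |I ∩ b|`. -/
def sI (π : Equiv.Perm (Fin n)) (k : ℕ) (b : Finset (Fin n)) : ℝ := ∑ l, io π k l * xa b l

/-- row factor types: `0 ↦ (1−x)(1−x')`, `1 ↦ x x'`, `2 ↦ x (1−x')`. -/
def row0 (a : Finset (Fin n)) (l l' : Fin n) : ℝ := (1 - xa a l) * (1 - xa a l')
def row1 (a : Finset (Fin n)) (l l' : Fin n) : ℝ := xa a l * xa a l'
def row2 (a : Finset (Fin n)) (l l' : Fin n) : ℝ := xa a l * (1 - xa a l')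

/-- the eight column factors (A1, A2, A3a, A3b, A4+A6, A5, A7, A8 of the header). -/
def col0 (lam : ℝ) (b : Finset (Fin n)) (π : Equiv.Perm (Fin n)) (k : ℕ) (l l' : Fin n) : ℝ :=
  io π k l * io π k l' * xa b l * xa b l'
def col1 (lam : ℝ) (b : Finset (Fin n)) (π : Equiv.Perm (Fin n)) (k : ℕ) (l l' : Fin n) : ℝ :=
  (1 - io π k l) * (1 - io π k l') * xa b l * xa b l'
def col2 (lam : ℝ) (b : Finset (Fin n)) (π : Equiv.Perm (Fin n)) (k : ℕ) (l l' : Fin n) : ℝ :=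
  (1 - io π k l) * io π k l' * (2 - 2 * xa b l * xa b l')
def col3 (lam : ℝ) (b : Finset (Fin n)) (π : Equiv.Perm (Fin n)) (k : ℕ) (l l' : Fin n) : ℝ :=
  (1 - io π k l) * io π k l' * 2
def col4 (lam : ℝ) (b : Finset (Fin n)) (π : Equiv.Perm (Fin n)) (k : ℕ) (l l' : Fin n) : ℝ :=
  (if l' = l then 1 else 0) * ((1 - io π k l) *
    (2 - 2 * xa b l + 2 * sI π k b * xa b l + (lam * (((π l : ℕ) : ℝ) + 1 - k) - 4 * k - 2)))
def col5 (lam : ℝ) (b : Finset (Fin n)) (π : Equiv.Perm (Fin n)) (k : ℕ) (l l' : Fin n) : ℝ :=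
  (if l' = l then 1 else 0) * (io π k l * (2 * k + 2 * (1 - sI π k b) * xa b l))
def col6 (lam : ℝ) (b : Finset (Fin n)) (π : Equiv.Perm (Fin n)) (k : ℕ) (l l' : Fin n) : ℝ :=
  lam * (1 - io π k l) * K π l' l
def col7 (lam : ℝ) (b : Finset (Fin n)) (π : Equiv.Perm (Fin n)) (k : ℕ) (l l' : Fin n) : ℝ :=
  lam * io π k l * io π k l' * K π l l'

/-- row factor of family `i`. -/
def rowv (i : Fin 8) (a : Finset (Fin n)) (l l' : Fin n) : ℝ :=
  ![row0 a l l', row1 a l l', row2 a l l', row1 a l l', row1 a l l', row0 a l l', row1 a l l',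
    row2 a l l'] i

/-- column factor of family `i`. -/
def colv (i : Fin 8) (lam : ℝ) (b : Finset (Fin n)) (π : Equiv.Perm (Fin n)) (k : ℕ)
    (l l' : Fin n) : ℝ :=
  ![col0 lam b π k l l', col1 lam b π k l l', col2 lam b π k l l', col3 lam b π k l l',
    col4 lam b π k l l', col5 lam b π k l l', col6 lam b π k l l', col7 lam b π k l l'] i

lemma rowv_nonneg (i : Fin 8) (a : Finset (Fin n)) (l l' : Fin n) : 0 ≤ rowv i a l l' := by
  have h0 : 0 ≤ row0 a l l' :=
    mul_nonneg (by linarith [xa_le_one a l]) (by linarith [xa_le_one a l'])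
  have h1 : 0 ≤ row1 a l l' := mul_nonneg (xa_nonneg a l) (xa_nonneg a l')
  have h2 : 0 ≤ row2 a l l' := mul_nonneg (xa_nonneg a l) (by linarith [xa_le_one a l'])
  fin_cases i <;> simp [rowv, h0, h1, h2]

lemma sI_nonneg (π : Equiv.Perm (Fin n)) (k : ℕ) (b : Finset (Fin n)) : 0 ≤ sI π k b :=
  Finset.sum_nonneg (fun l _ => mul_nonneg (io_nonneg π k l) (xa_nonneg b l))

lemma sI_le (π : Equiv.Perm (Fin n)) (k : ℕ) (hk : k ≤ n) (b : Finset (Fin n)) :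
    sI π k b ≤ k := by
  calc sI π k b ≤ ∑ l, io π k l := by
        refine Finset.sum_le_sum (fun l _ => ?_)
        have := mul_le_mul_of_nonneg_left (xa_le_one b l) (io_nonneg π k l)
        simpa using this
    _ = k := sum_io π k hk

lemma colv_nonneg (i : Fin 8) (lam : ℝ) (b : Finset (Fin n)) (π : Equiv.Perm (Fin n)) (k : ℕ)
    (hk : k ≤ n) (hlam : 4 * (n : ℝ) + 2 ≤ lam) (l l' : Fin n) : 0 ≤ colv i lam b π k l l' := by
  have hι := io_nonneg π k l
  have hι' := io_nonneg π k l'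
  have hι1 : 0 ≤ 1 - io π k l := by linarith [io_le_one π k l]
  have hι1' : 0 ≤ 1 - io π k l' := by linarith [io_le_one π k l']
  have hβ := xa_nonneg b l
  have hβ' := xa_nonneg b l'
  have hβ1 := xa_le_one b l
  have hβ1' := xa_le_one b l'
  have hs := sI_nonneg π k b
  have hsk := sI_le π k hk b
  have hkn : (k : ℝ) ≤ n := by exact_mod_cast hk
  have hlam0 : 0 ≤ lam := by linarith [(Nat.cast_nonneg n : (0 : ℝ) ≤ n)]
  have h0 : 0 ≤ col0 lam b π k l l' := by unfold col0; positivity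
  have h1 : 0 ≤ col1 lam b π k l l' := by
    unfold col1; exact mul_nonneg (mul_nonneg (mul_nonneg hι1 hι1') hβ) hβ'
  have h2 : 0 ≤ col2 lam b π k l l' := by
    unfold col2
    refine mul_nonneg (mul_nonneg hι1 hι') ?_
    nlinarith [mul_le_mul hβ1 hβ1' hβ' (by norm_num : (0 : ℝ) ≤ 1)]
  have h3 : 0 ≤ col3 lam b π k l l' := by
    unfold col3; exact mul_nonneg (mul_nonneg hι1 hι') (by norm_num)
  have h4 : 0 ≤ col4 lam b π k l l' := by
    unfold col4
    refine mul_nonneg (by split_ifs <;> norm_num) ?_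
    -- `(1 - io) * (...)`: if `io = 1` the product vanishes; else `π l ≥ k`.
    by_cases hlt : (π l : ℕ) < k
    · have : io π k l = 1 := by simp [io, hlt]
      rw [this]; simp
    · have hio : io π k l = 0 := by simp [io, hlt]
      have hpos : (k : ℝ) ≤ ((π l : ℕ) : ℝ) := by exact_mod_cast (not_lt.mp hlt)
      rw [hio]
      have hA : 0 ≤ 2 - 2 * xa b l + 2 * sI π k b * xa b l := by nlinarith
      have hB : 0 ≤ lam * (((π l : ℕ) : ℝ) + 1 - k) - 4 * k - 2 := by nlinarith
      linarith
  have h5 : 0 ≤ col5 lam b π k l l' := by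
    unfold col5
    refine mul_nonneg (by split_ifs <;> norm_num) (mul_nonneg hι ?_)
    nlinarith
  have h6 : 0 ≤ col6 lam b π k l l' := by
    unfold col6; exact mul_nonneg (mul_nonneg hlam0 hι1) (K_nonneg π l' l)
  have h7 : 0 ≤ col7 lam b π k l l' := by
    unfold col7; exact mul_nonneg (mul_nonneg (mul_nonneg hlam0 hι) hι') (K_nonneg π l l')
  fin_cases i <;> simp [colv, h0, h1, h2, h3, h4, h5, h6, h7]

/-! ## §3 The identity -/

/-- scalar statistics of a row `a` against the located set `I^π_k` and the column set `b`. -/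
def tQ (a b : Finset (Fin n)) (π : Equiv.Perm (Fin n)) (k : ℕ) : ℝ :=
  ∑ l, xa a l * (1 - io π k l) * xa b l
def mQ (a b : Finset (Fin n)) (π : Equiv.Perm (Fin n)) (k : ℕ) : ℝ :=
  ∑ l, (1 - xa a l) * io π k l * xa b l
def dQ (a : Finset (Fin n)) (π : Equiv.Perm (Fin n)) (k : ℕ) : ℝ := ∑ l, xa a l * (1 - io π k l)
def dQ' (a : Finset (Fin n)) (π : Equiv.Perm (Fin n)) (k : ℕ) : ℝ := ∑ l, (1 - xa a l) * io π k l
def eQ (a : Finset (Fin n)) (π : Equiv.Perm (Fin n)) (k : ℕ) : ℝ := ∑ l, xa a l * io π k l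
/-- the leading budget `Σ_{l ∈ a∖I} (π l + 1 − k)`. -/
def A6K (a : Finset (Fin n)) (π : Equiv.Perm (Fin n)) (k : ℕ) : ℝ :=
  ∑ l, xa a l * (1 - io π k l) * (((π l : ℕ) : ℝ) + 1 - k)
def F7 (a : Finset (Fin n)) (π : Equiv.Perm (Fin n)) (k : ℕ) : ℝ :=
  ∑ l, ∑ l', xa a l * xa a l' * ((1 - io π k l) * K π l' l)
def F8 (a : Finset (Fin n)) (π : Equiv.Perm (Fin n)) (k : ℕ) : ℝ :=
  ∑ l, ∑ l', xa a l * (1 - xa a l') * (io π k l * io π k l' * K π l l')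

/-- The inversion count splits along the located set:
`inv = Σ_{l∈a∖I}(π l + 1 − k) + F7 + F8` (for `|a| = k`). -/
lemma invR_split (a : Finset (Fin n)) (π : Equiv.Perm (Fin n)) (k : ℕ) (hak : a.card = k) :
    invR a π = A6K a π k + F7 a π k + F8 a π k := by
  have hk : k ≤ n := by
    rw [← hak]; exact le_trans (Finset.card_le_univ a) (by simp)
  unfold invR A6K F7 F8
  rw [← Finset.sum_add_distrib, ← Finset.sum_add_distrib]
  refine Finset.sum_congr rfl (fun l _ => ?_)
  by_cases hl : l ∈ a
  · have hxl : xa a l = 1 := by simp [xa, hl]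
    by_cases hι : (π l : ℕ) < k
    · have hιl : io π k l = 1 := by simp [io, hι]
      simp only [hxl, hιl, sub_self, mul_zero, zero_mul, zero_add, one_mul, Finset.sum_const_zero]
      -- goal: Σ (1 - x') K = Σ (1 - x') (ι' K)
      refine Finset.sum_congr rfl (fun l' _ => ?_)
      have h := io_K_io π k l l'
      rw [hιl] at h
      -- K * (1 - ι') = 0  ⇒  (1 - x') K = (1 - x') ι' K
      linear_combination (1 - xa a l') * h
    · have hιl : io π k l = 0 := by simp [io, hι]
      simp only [hxl, hιl, sub_zero, mul_one, one_mul, zero_mul, mul_zero, Finset.sum_const_zero,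
        add_zero]
      -- goal: Σ (1 - x') K_{ll'} = (π l + 1 - k) + Σ x' K_{l'l}
      have hKK : ∑ l', xa a l' * (K π l l' + K π l' l) = (k : ℝ) - 1 := by
        have h1 : ∀ l', xa a l' * (K π l l' + K π l' l) =
            xa a l' - (if l' = l then xa a l' else 0) := by
          intro l'
          rw [K_add_K π l l']
          by_cases h : l = l'
          · subst h; simp
          · have h' : ¬ l' = l := fun e => h e.symm
            simp [h, h']
        simp_rw [h1]
        rw [Finset.sum_sub_distrib, sum_xa a, hak]
        simp [hxl]
      have hsK := sum_K π l
      have e1 : ∑ l', (1 - xa a l') * K π l l' = ∑ l', K π l l' - ∑ l', xa a l' * K π l l' := by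
        rw [← Finset.sum_sub_distrib]
        refine Finset.sum_congr rfl (fun l' _ => by ring)
      have e2 : ∑ l', xa a l' * (K π l l' + K π l' l) =
          ∑ l', xa a l' * K π l l' + ∑ l', xa a l' * K π l' l := by
        rw [← Finset.sum_add_distrib]
        refine Finset.sum_congr rfl (fun l' _ => by ring)
      rw [e1, hsK]
      rw [e2] at hKK
      linarith
  · have hxl : xa a l = 0 := by simp [xa, hl]
    simp [hxl]

/-- **The explicit factorization identity** (per size class `k = |a|`):
`UDISJ + λ·inv = (1 − s')² + Σ_{i<8} Σ_{l,l'} rowᵢ · colᵢ`. -/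
theorem slack_identity (lam : ℝ) (a b : Finset (Fin n)) (π : Equiv.Perm (Fin n)) (k : ℕ)
    (hak : a.card = k) :
    M lam a b π = (1 - sI π k b) ^ 2 +
      ∑ i : Fin 8, ∑ l, ∑ l', rowv i a l l' * colv i lam b π k l l' := by
  have hk : k ≤ n := by
    rw [← hak]; exact le_trans (Finset.card_le_univ a) (by simp)
  -- name the scalar statistics
  set s := ∑ l, xa a l * xa b l with hs_def
  set s' := sI π k b with hs'_def
  set m := mQ a b π k with hm_def
  set t := tQ a b π k with ht_def
  set d := dQ a π k with hd_def
  set d' := dQ' a π k with hd'_def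
  set e := eQ a π k with he_def
  -- relations among them
  have hxe : e = (k : ℝ) - d := by
    have : e + d = ∑ l, xa a l := by
      rw [he_def, hd_def, eQ, dQ, ← Finset.sum_add_distrib]
      refine Finset.sum_congr rfl (fun l _ => by ring)
    rw [sum_xa a, hak] at this; linarith
  have hdd : d' = d := by
    have h1 : d' + e = ∑ l, io π k l := by
      rw [hd'_def, he_def, dQ', eQ, ← Finset.sum_add_distrib]
      refine Finset.sum_congr rfl (fun l _ => by ring)
    rw [sum_io π k hk] at h1
    linarith
  have hss : s = s' - m + t := by
    rw [hs_def, hs'_def, hm_def, ht_def, sI, mQ, tQ, ← Finset.sum_sub_distrib,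
      ← Finset.sum_add_distrib]
    refine Finset.sum_congr rfl (fun l _ => by ring)
  -- the eight families evaluated
  have hF0 : ∑ l, ∑ l', rowv 0 a l l' * colv 0 lam b π k l l' = m * m := by
    rw [hm_def, mQ, ← dsum_prod]
    exact dsum_congr (fun l l' => by simp [rowv, colv, row0, col0]; try ring)
  have hF1 : ∑ l, ∑ l', rowv 1 a l l' * colv 1 lam b π k l l' = t * t := by
    rw [ht_def, tQ, ← dsum_prod]
    exact dsum_congr (fun l l' => by simp [rowv, colv, row1, col1]; try ring)
  have hF2 : ∑ l, ∑ l', rowv 2 a l l' * colv 2 lam b π k l l' = 2 * (d * d') - 2 * (t * m) := by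
    rw [hd_def, hd'_def, ht_def, hm_def, dQ, dQ', tQ, mQ, ← dsum_prod, ← dsum_prod,
      ← dsum_const_mul, ← dsum_const_mul, ← dsum_sub]
    exact dsum_congr (fun l l' => by simp [rowv, colv, row2, col2]; try ring)
  have hF3 : ∑ l, ∑ l', rowv 3 a l l' * colv 3 lam b π k l l' = 2 * (d * e) := by
    rw [hd_def, he_def, dQ, eQ, ← dsum_prod, ← dsum_const_mul]
    exact dsum_congr (fun l l' => by simp [rowv, colv, row1, col3]; try ring)
  have hF4 : ∑ l, ∑ l', rowv 4 a l l' * colv 4 lam b π k l l' =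
      (2 * d - 2 * t + 2 * s' * t) + (lam * A6K a π k - (4 * k + 2) * d) := by
    have e1 : ∑ l, ∑ l', rowv 4 a l l' * colv 4 lam b π k l l' =
        ∑ l, ∑ l', (if l' = l then (1 : ℝ) else 0) * (xa a l * xa a l' * ((1 - io π k l) *
          (2 - 2 * xa b l + 2 * sI π k b * xa b l +
            (lam * (((π l : ℕ) : ℝ) + 1 - k) - 4 * k - 2)))) :=
      dsum_congr (fun l l' => by simp [rowv, colv, row1, col4]; try ring)
    rw [e1, dsum_delta]
    rw [hd_def, ht_def, hs'_def, dQ, tQ, A6K]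
    simp only [Finset.mul_sum, ← Finset.sum_sub_distrib, ← Finset.sum_add_distrib]
    refine Finset.sum_congr rfl (fun l _ => ?_)
    have := xa_mul_self a l
    linear_combination ((1 - io π k l) * (2 - 2 * xa b l + 2 * sI π k b * xa b l +
      (lam * (((π l : ℕ) : ℝ) + 1 - k) - 4 * k - 2))) * this
  have hF5 : ∑ l, ∑ l', rowv 5 a l l' * colv 5 lam b π k l l' =
      2 * k * d' + 2 * (1 - s') * m := by
    have e1 : ∑ l, ∑ l', rowv 5 a l l' * colv 5 lam b π k l l' =
        ∑ l, ∑ l', (if l' = l then (1 : ℝ) else 0) * ((1 - xa a l) * (1 - xa a l') *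
          (io π k l * (2 * k + 2 * (1 - sI π k b) * xa b l))) :=
      dsum_congr (fun l l' => by simp [rowv, colv, row0, col5]; try ring)
    rw [e1, dsum_delta]
    rw [hd'_def, hm_def, hs'_def, dQ', mQ]
    simp only [Finset.mul_sum, ← Finset.sum_add_distrib]
    refine Finset.sum_congr rfl (fun l _ => ?_)
    have := xa_mul_self a l
    linear_combination (io π k l * (2 * (k : ℝ) + 2 * (1 - sI π k b) * xa b l)) * this
  have hF6 : ∑ l, ∑ l', rowv 6 a l l' * colv 6 lam b π k l l' = lam * F7 a π k := by
    rw [F7, ← dsum_const_mul]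
    exact dsum_congr (fun l l' => by simp [rowv, colv, row1, col6]; try ring)
  have hF7 : ∑ l, ∑ l', rowv 7 a l l' * colv 7 lam b π k l l' = lam * F8 a π k := by
    rw [F8, ← dsum_const_mul]
    exact dsum_congr (fun l l' => by simp [rowv, colv, row2, col7]; try ring)
  -- assemble
  have hinv := invR_split a π k hak
  rw [Fin.sum_univ_eight, hF0, hF1, hF2, hF3, hF4, hF5, hF6, hF7]
  unfold M
  rw [← hs_def, hinv, hss, hdd, hxe]
  ring

/-! ## §4 Packaging: a nonnegative factorization with `(n+1)(8n²+1)` slots -/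

/-- slot index: a size class `k` and either the constant atom or a family/pair atom. -/
abbrev Slot (n : ℕ) := Fin (n + 1) × Option (Fin 8 × Fin n × Fin n)

lemma card_Slot (n : ℕ) : Fintype.card (Slot n) = (n + 1) * (8 * n ^ 2 + 1) := by
  simp [Slot, Fintype.card_prod, Fintype.card_option, Fintype.card_fin]
  ring

/-- the row matrix `U`. -/
def U (a : Finset (Fin n)) : Slot n → ℝ
  | (k, none) => if a.card = (k : ℕ) then 1 else 0
  | (k, some (i, l, l')) => (if a.card = (k : ℕ) then 1 else 0) * rowv i a l l'

/-- the column matrix `V`. -/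
def V (lam : ℝ) (c : Finset (Fin n) × Equiv.Perm (Fin n)) : Slot n → ℝ
  | (k, none) => (1 - sI c.2 k c.1) ^ 2
  | (k, some (i, l, l')) => colv i lam c.1 c.2 k l l'

lemma U_nonneg (a : Finset (Fin n)) (s : Slot n) : 0 ≤ U a s := by
  rcases s with ⟨k, _ | ⟨i, l, l'⟩⟩
  · simp only [U]; split_ifs <;> norm_num
  · simp only [U]
    exact mul_nonneg (by split_ifs <;> norm_num) (rowv_nonneg i a l l')

lemma V_nonneg (lam : ℝ) (hlam : 4 * (n : ℝ) + 2 ≤ lam) (c : Finset (Fin n) × Equiv.Perm (Fin n))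
    (s : Slot n) : 0 ≤ V lam c s := by
  rcases s with ⟨k, _ | ⟨i, l, l'⟩⟩
  · simp only [V]; positivity
  · simp only [V]
    exact colv_nonneg i lam c.1 c.2 k (Nat.lt_succ_iff.mp k.isLt) hlam l l'

/-- the factorization `M = U · Vᵀ`. -/
theorem factorization (lam : ℝ) (a b : Finset (Fin n)) (π : Equiv.Perm (Fin n)) :
    ∑ s : Slot n, U a s * V lam (b, π) s = M lam a b π := by
  have hcard : a.card < n + 1 :=
    Nat.lt_succ_of_le (le_trans (Finset.card_le_univ a) (by simp))
  set k₀ : Fin (n + 1) := ⟨a.card, hcard⟩ with hk₀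
  rw [Fintype.sum_prod_type]
  rw [Finset.sum_eq_single k₀]
  · -- the size class of `a`
    rw [Fintype.sum_option]
    have hU0 : U a (k₀, none) = 1 := by simp [U, hk₀]
    rw [hU0, one_mul]
    simp only [V]
    rw [slack_identity lam a b π (k₀ : ℕ) (by simp [hk₀])]
    congr 1
    rw [Fintype.sum_prod_type, Finset.sum_comm]
    rw [Finset.sum_comm]
    refine Finset.sum_congr rfl (fun i _ => ?_)
    rw [Fintype.sum_prod_type]
    refine Finset.sum_congr rfl (fun l _ => Finset.sum_congr rfl (fun l' _ => ?_))
    simp [U, hk₀]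
  · intro k _ hk
    have hne : ¬ a.card = (k : ℕ) := by
      intro h; apply hk; apply Fin.ext; simp [hk₀, h]
    apply Finset.sum_eq_zero
    intro o _
    rcases o with _ | ⟨i, l, l'⟩ <;> simp [U, hne]
  · intro h; exact absurd (Finset.mem_univ k₀) h

/-- **Main theorem.**  The permutahedral passenger `Q^Π_{4n+2}` is clique-row blind:
`(1 − |a∩b|)² + (4n+2)·inv(a;π)` has a nonnegative factorization with `(n+1)(8n²+1)` slots. -/
theorem permPassenger_cliqueBlind (n : ℕ) :
    ∃ (U : Finset (Fin n) → Slot n → ℝ) (V : Finset (Fin n) × Equiv.Perm (Fin n) → Slot n → ℝ),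
      Fintype.card (Slot n) = (n + 1) * (8 * n ^ 2 + 1) ∧
      (∀ a s, 0 ≤ U a s) ∧ (∀ c s, 0 ≤ V c s) ∧
      ∀ (a b : Finset (Fin n)) (π : Equiv.Perm (Fin n)),
        (1 - ((a ∩ b).card : ℝ)) ^ 2 + (4 * n + 2) * (inv a π : ℝ) = ∑ s, U a s * V (b, π) s := by
  refine ⟨U, V (4 * n + 2), card_Slot n, U_nonneg, V_nonneg _ le_rfl, ?_⟩
  intro a b π
  rw [factorization, M, sum_xa_mul_xa, inv_cast]

end

end Summit.ValiantsHypothesis.ValiantsHypothesis.Cruxes.NNDivisionHard.PermBlind41
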